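import Summits.QuantumFields.YangMills.Theorems.BalabanUVNodesN22AtRecordOfKernelFading
import Summits.QuantumFields.YangMills.Theorems.BalabanUVNodesN22WindowedNE9OfStripSchemas

/-!
# BalabanUVNodes ∕ node N22 = NE9 — «J35 AT THE RECORD» REPAIRED: K3⁷ v5 §2b's `h9` WITH THE RECORD's GEOMETRIC MODULI from node N18's kernel step rate + THE PER-STEP SCHEMAS
# (node N10's older-coupling (2.14)–(2.26) on a common complex domain + node N09's `EHoloAt` families + Lemma 3's numerals) + readings ∕ tails ∕ W1-20's law ∕ (1.21) — NO `hdom`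
# row against a uniform table (module J37: that junction is vacuous modulo degenerate data), the geometric gain being node N18's (modules J38–J41)

Cell `pub-ymgap`, HUMAN RULING D-0062 (Track A), R134 seat `pub-ymgap-dag-n22-c` (strategy s1), generation 14, module J42.  THEOREMS ONLY (no `def`, no `sorry`, standard axioms);
`--kind proof --supports stmt-QuantumFields-20544 --as helper` (K3⁷ `SpineGivenEndpointR13SepCoPH`, skeleton v5 941dddb108cb), COUNT-NEUTRAL.  Imports J40
`…Theorems.BalabanUVNodesN22AtRecordOfKernelFading` and J35 `…Theorems.BalabanUVNodesN22WindowedNE9OfStripSchemas` (`outputCoordHolo_of_stripSchemas`: the OUTPUT-LEVEL margin datum with ONE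
radius `r_E` from the strip schemas).  Nothing re-declared; one application.

THE POINT.  dag-n22-w5's p618341 §2 (`ne9_EA_objectsOfRecord₁₃_of_stripSchemas`) reads v5 §2b's `h9` from the per-step schemas through MY J35's UNIFORM (β′) table and a row
`hdom : C·4E₀∕r_E ≤ ℓ.moduli n i`; module J37 shows `hdom ∧ ℓ.Signs ⇒ B₃ = 0 ∨ E₀ ≤ 0` (zero weights or zero towers).  THIS FILE gives the same conclusion from the SAME per-step inputs
WITHOUT `hdom`: the strip schemas feed J35 §1's `outputCoordHolo_of_stripSchemas` (margin datum, radius `r_E`, bound `E₀e^{−κd}`), J41 turns it into the uniform kernel decay of record,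
J39∕J40 into the kernel second-difference letter, and node N18's kernel step rate of record supplies the GEOMETRIC gain (J38, dag-n22-a's `N22KnitDiscrete`).  The extra displayed inputs
w.r.t. p618341 §2 are node N18's `KernelStepRateOfRecord₁₃ F N θ κ₅ ℓ.θ₅ C₅` (ALREADY an input of the same stub) and term holomorphy through the readings at EVERY window history; the
letter rows replace `hℓκ ∕ hdom`: `δ₁ ≤ κ₅`, `0 < ℓ.ω`, `ℓ.θ₅ ≤ ℓ.ω²`, `ℓ.κ ≤ δ₁`, `(4·(2C₅∕(1−θ₅) + 2E₁)∕γ + C₂γ∕2)∕ℓ.ω ≤ ℓ.C₉` with `E₁ = (16E₀B₃²∕r²)eK₀K₁`,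
`C₂ = (16·(64E₀∕r_E²)·B₃²∕r²)eK₀K₁`, `e = e^{12Mδ₁}`, `δ₁ = ½min{δ₀, κ_w(4M)⁻¹}` — JOINTLY SATISFIABLE with `ℓ.Signs`.
* ★★★ `ne9_EA_objectsOfRecord₁₃_of_kernelStepRate_stripSchemas`; ★★★ `n22At_rateCarriers_of_kernels_pin_of_kernelStepRate_stripSchemas` (the pin face, every run length);
  §2 ★ `exists_letterBlock_rows` — the letter rows are JOINTLY SATISFIABLE with `ℓ.Signs` (explicit block `ω = ρ = (1+√θ₅)∕2`), so this junction is not degenerate-only.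

HONEST FRAMING (binding).  Count-neutral COMPOSITION; NO estimate of Bałaban's is proved or asserted; displayed with owners: `h226TOnOlder` (N10 — the common complex domain is the cell's
complexification «(or analytic)», NOT a printed display), the `EHoloAt` families at `sfTowerOfRecord` (N09), the numerals (Lemma 3's socket), node N18's kernel step rate (N18; NE5 NOT PRINTED
for d = 4), readings ∕ term holomorphy through them ∕ tails (NODE A ∕ N09), the law (def-W1 ∕ NODE A), (1.21) (dag-n22-w3's road); nothing of the record is constructed or claimed to meet
them; N22 is NOT discharged (typed 28∕28 · discharged 5∕27 UNCHANGED); K3⁷ OPEN and NOT claimed; NE9 is NOT IN PRINT for d = 4; no count claim; one finite 𝕋⁴ programme at fixed ε — R4 closes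
the CONDITIONAL rung `BalabanLadder.UV` only; NOTHING about the continuum limit, ℝ⁴, infinite volume, OS axioms, a mass gap or the Clay problem is proved or claimed.  References (TYPES
only): [I] = Bałaban, CMP 109 (1987) Thm 1 p. 259, (1.7) p. 261, §1 p. 263 with (1.18), (1.20)–(1.22) p. 264, §2 p. 266, p. 282, (5.10) p. 293; [II] = CMP 116 (1988) (2.3) p. 12,
(2.13)–(2.26) pp. 14–17, Lemma 3 (2.38) p. 20, (2.39)–(2.41) p. 21.
-/

noncomputable section

open Filter Topology Set Metric
open scoped BigOperators

namespace YMDAG.N22.KernelFading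

open Literature.MathematicalPhysics.QuantumFieldTheory.Balaban1983to89
open Literature.MathematicalPhysics.QuantumFieldTheory.Balaban1983to89.T4Continuum (T4Family ULoop)
open Literature.MathematicalPhysics.QuantumFieldTheory.Balaban1983to89.T4OutputRate (Window NE9)
open Literature.MathematicalPhysics.QuantumFieldTheory.Balaban1983to89.TreeLengthTorus (TPt TDom torusTreeLen)
open Literature.MathematicalPhysics.QuantumFieldTheory.Balaban1983to89.B12TreeDecay (K₀ kappa₀ K₀_pos)
open Literature.MathematicalPhysics.QuantumFieldTheory.Balaban1983to89.B12Decay510 (delta1)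
open Literature.MathematicalPhysics.QuantumFieldTheory.Balaban1983to89.B12Decay510Window (K₁)
open Literature.MathematicalPhysics.QuantumFieldTheory.Balaban1983to89.B12Decay510Torus (distCT nearT)
open Literature.MathematicalPhysics.QuantumFieldTheory.Balaban1983to89.B13Lemma3TorusData (TBond)
open Literature.MathematicalPhysics.QuantumFieldTheory.Balaban1983to89.B13Lemma3TorusTerms (terms weight)
open Literature.MathematicalPhysics.QuantumFieldTheory.Balaban1983to89.B13Lemma3TorusSocket (Lemma3Numerics)
open Literature.MathematicalPhysics.QuantumFieldTheory.Balaban1983to89.B12BetaHolo (EHoloAt)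
open Literature.MathematicalPhysics.QuantumFieldTheory.Balaban1983to89.Step (SFConsts)
open Literature.MathematicalPhysics.QuantumFieldTheory.Balaban1983to89.Node00
open Literature.MathematicalPhysics.QuantumFieldTheory.Balaban1983to89.Node00.Sect2 (domSys domCount CPair spaceI domSites Setting Residual)
open Literature.MathematicalPhysics.QuantumFieldTheory.Balaban1983to89.Node00.W1
open Literature.MathematicalPhysics.QuantumFieldTheory.Balaban1983to89.Node00.LocalizedSum17 (localizedSum ReadingMaps Localizes17OfRecord₁₃)
open Literature.MathematicalPhysics.QuantumFieldTheory.Balaban1983to89.Node00.U3OfKernels (histPrefix objectsOfRecord₁₃)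
open Literature.MathematicalPhysics.QuantumFieldTheory.Balaban1983to89.Node00.U3KernelLetters (KernelStepRateOfRecord₁₃ PolLimitsExistOfRecord₁₃)
open YMDAG.UVSplit (N22At RateReading₁₃CoPH rateCarriersOfRecord₁₃CoPH)
open YMDAG.N22.AtKernels (n22At_rateCarriers_of_kernels_pin_of_ne9)
open YMDAG.N22.OutputLevel (outputCoordHolo_of_stripSchemas)

open scoped Matrix.Norms.L2Operator

variable (F : T4Family) (N : ℕ) [NeZero N]

open Classical in
/-- ★★★ **«J35 AT THE RECORD» REPAIRED — v5 §2b's `h9` WITH THE RECORD's GEOMETRIC MODULI FROM NODE N18's KERNEL STEP RATE + THE PER-STEP SCHEMAS, NO `hdom`.**  Towers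
`S K : ClusterTower (F.P K) 𝔸 M` (`M = L_F^{m′}`) read through `emb : ReadingMaps F (MatA N) 𝔸` with W1-20's law at the space tables of record `U^c_{k+1}(X, cs.α₀, cs.α₁)` of the settings
`(Sg K, Rz K)`; per torus: node N10's `h226TOnOlder` UNIVERSAL IN THE DOMAIN, node N09's `EHoloAt (sfTowerOfRecord …) cs k` per window history and step with uniform letters `(E₀, r_E > 0)`,
the socket numerals, `8 ≤ c.L`, S25's clauses at `A := C₃ε₁`, the renewal row, `θ.γ ≤ cs.γ`, `κ ≤ cs.κ`; term holomorphy through the complexified readings of record at every window history,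
chart∕space clauses, site weights with tails, `δ₀ > 0`, `2κ₀(64,8) ≤ κ_w ≤ κ`; `PolLimitsExistOfRecord₁₃ F N θ`; node N18's `KernelStepRateOfRecord₁₃ F N θ κ₅ ℓ.θ₅ C₅` (`C₅ ≥ 0`); the letter
rows `δ₁ ≤ κ₅`, `0 < ℓ.ω`, `ℓ.θ₅ ≤ ℓ.ω²`, `ℓ.κ ≤ δ₁`, `(4·(2C₅∕(1−ℓ.θ₅) + 2E₁)∕θ.γ + C₂·θ.γ∕2)∕ℓ.ω ≤ ℓ.C₉` ⟹ **`NE9 ((objectsOfRecord₁₃ F N θ ℓ).EA 0) (Window θ.γ) ℓ.κ ℓ.moduli`** —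
J35 §1 `outputCoordHolo_of_stripSchemas` into J40 §2′ `ne9_EA_objectsOfRecord₁₃_of_kernelStepRate_outputCoordHolo'`.  LOCATED (hypothesis form); N22 NOT discharged. [folklore] -/
theorem ne9_EA_objectsOfRecord₁₃_of_kernelStepRate_stripSchemas (θ : Stage13Params F N) (ℓ : U3Letters₁₁) (hs : ℓ.Signs) (hγ0 : 0 < θ.γ)
    (hlim : PolLimitsExistOfRecord₁₃ F N θ) {κ₅ C₅ : ℝ} (hC₅ : 0 ≤ C₅) (h5 : KernelStepRateOfRecord₁₃ F N θ κ₅ ℓ.θ₅ C₅)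
    {𝔸 : Type*} [NormedRing 𝔸] [NormedAlgebra ℂ 𝔸] [CompleteSpace 𝔸] {G : Type*} [GaugeGroup G]
    (m' : ℕ) (M : ℕ) [NeZero M] (hM : M = F.L ^ m')
    (S : (K : ℕ) → ClusterTower (F.P K) 𝔸 M) (emb : ReadingMaps F (MatA N) 𝔸) (hloc : Localizes17OfRecord₁₃ F N θ S emb)
    (Sg : (K : ℕ) → Setting 𝔸 G) (Rz : (K : ℕ) → Residual (F.P K) 𝔸) (logZ : (K : ℕ) → ℕ → GaugeField (F.P K) 0 G → ℝ) (β : ℕ → ℕ → ℝ → ℝ)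
    (c : B13.Consts) {L : ℕ} [NeZero L] (hL : 8 ≤ c.L) (hLc : c.L = L) {a a₂ a₂' a₅ Aabs : ℝ} (hN : Lemma3Numerics c M ((c.L : ℝ) / 2) a a₂ a₂' a₅ Aabs)
    (cs : SFConsts) (hγ : θ.γ ≤ cs.γ)
    {rE E₀ κ r₁ κw δ₀ B₃ r : ℝ} (hrE : 0 < rE) (hA0 : 0 ≤ c.C3act * c.ε₁) (hr₁ : 0 ≤ r₁) (hκ : κ ≤ r₁)
    (hrate : r₁ + 2 * (64 * Real.log 162) + 2 ≤ (1 - 8 * c.δ) * ((c.L : ℝ) / 2) * c.κ)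
    (hsmall : c.C3act * c.ε₁ * Real.exp (5 * r₁ + 1) * K₀ 64 8 * 9 * 64 ≤ 1)
    (hrenew : Real.exp 1 * 9 * 64 * K₀ 64 8 ^ 2 * (c.C3act * c.ε₁) ≤ E₀) (hκc : κ ≤ cs.κ)
    (hκ₀ : kappa₀ (4 * 2 ^ 4) (2 * 4) ≤ κw / 2) (hκw : κw ≤ κ) (hδ₀ : 0 < δ₀) (hB₃ : 0 ≤ B₃) (hr : 0 < r)
    (h226TOnOlder : ∀ K : ℕ,
      ∀ (D : Set ℂ), IsOpen D → (∀ t ∈ Ioc (0 : ℝ) θ.γ, closedBall (t : ℂ) rE ⊆ D) →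
        ∀ (k : ℕ) (g : ℕ → ℝ), g ∈ Window θ.γ → ∀ (i : ℕ), i < k → ∀ (X : (domSys (F.P K) M (k + 1)).Dom) (φ : CPair (F.P K) 𝔸),
        φ ∈ spaceI (Sg K) (Rz K) M (k + 1) (domSites (F.P K) M (k + 1) X) cs.α₀ cs.α₁ →
        (∀ (j : ℕ), j < k + 1 → ∀ (Y : (domSys (F.P K) M j).Dom) (ψ : CPair (F.P K) 𝔸), ψ ∈ spaceI (Sg K) (Rz K) M j (domSites (F.P K) M j Y) cs.α₀ cs.α₁ →
          ∃ Ec : ℂ → ℂ, DifferentiableOn ℂ Ec D ∧ (∀ z ∈ D, ‖Ec z‖ ≤ E₀ * Real.exp (-(κ * torusTreeLen Y.1))) ∧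
            (∀ t ∈ Ioc (0 : ℝ) θ.γ, Ec t = termC (S K) j Y (Function.update g i t) ψ)) →
        ∃ (Hc : ℂ → TDom 4 (domCount (F.P K) M (k + 1)) → ℂ)
          (Tt : (Z : TDom 4 (domCount (F.P K) M (k + 1))) →
            Finset (TDom 4 (L * domCount (F.P K) M (k + 1))) × Finset (TBond 4 M (L * domCount (F.P K) M (k + 1))) → ℂ → ℂ),
          (∀ Z : (domSys (F.P K) M (k + 1)).Dom, Z.1 ⊆ X.1 → DifferentiableOn ℂ (fun z => Hc z Z) D) ∧
          (∀ z ∈ D, ∀ Z : TDom 4 (domCount (F.P K) M (k + 1)), Z.1 ⊆ X.1 → ‖Hc z Z‖ ≤ ∑ t ∈ terms L M Z, ‖Tt Z t z‖) ∧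
          (∀ z ∈ D, ∀ Z : TDom 4 (domCount (F.P K) M (k + 1)), Z.1 ⊆ X.1 → ∀ t ∈ terms L M Z,
            ‖Tt Z t z‖ ≤ weight L M c Z a t * Real.exp (a₅ * ((Z.1).card : ℝ))) ∧
          (∀ t ∈ Ioc (0 : ℝ) θ.γ, Hc t = ((S K) k).H (restrictPrefix k (Function.update g i t)) φ))
    (hE : ∀ (K : ℕ), ∀ g ∈ Window θ.γ, ∀ k : ℕ, ∃ H : EHoloAt (sfTowerOfRecord (Sg K) (Rz K) M (S K) ⟨g, β K⟩ (logZ K)) cs k, H.E₀ ≤ E₀ ∧ rE ≤ H.r)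
    (Ec : ℕ → ℕ → Type*) [∀ K k, NormedAddCommGroup (Ec K k)] [∀ K k, NormedSpace ℂ (Ec K k)]
    (ι : letI := θ.instVβ₁; letI := θ.instVβ₂
      (K k : ℕ) → (domSys (F.P K) M (k + 1)).Dom → ((Fin (F.P K).d → Site (F.P K) (k + 1) → θ.Vβ) →L[ℝ] Ec K k))
    (Φ : (K k : ℕ) → (domSys (F.P K) M (k + 1)).Dom → Ec K k → CPair (F.P K) 𝔸)
    (U : (K k : ℕ) → (domSys (F.P K) M (k + 1)).Dom → Set (Ec K k)) (hU : ∀ K k X, IsOpen (U K k X)) (hrU : ∀ K k X, ball (0 : Ec K k) r ⊆ U K k X)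
    (hEhol : ∀ g ∈ Window θ.γ, ∀ (K k : ℕ) (X : (domSys (F.P K) M (k + 1)).Dom),
      DifferentiableOn ℂ (fun z => ((S K) k).E (histPrefix g k) (Φ K k X z) X) (U K k X))
    (hΦemb : letI := θ.instVβ₁; letI := θ.instVβ₂
      ∀ (K k : ℕ) (X : (domSys (F.P K) M (k + 1)).Dom) (B : Fin (F.P K).d → Site (F.P K) (k + 1) → θ.Vβ),
        Φ K k X (ι K k X B) = emb K k (fun l t => NormedSpace.exp (θ.ρ8 (B l t))))
    (hΦsp : ∀ (K k : ℕ) (X : (domSys (F.P K) M (k + 1)).Dom), ∀ z ∈ ball (0 : Ec K k) r,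
      Φ K k X z ∈ spaceI (Sg K) (Rz K) M (k + 1) (domSites (F.P K) M (k + 1) X) cs.α₀ cs.α₁)
    (w : (K k : ℕ) → (domSys (F.P K) M (k + 1)).Dom → Site (F.P K) (k + 1) → ℝ) (hw₀ : ∀ K k X t, 0 ≤ w K k X t)
    (hw : letI := θ.instVβ₁; letI := θ.instVβ₂; letI := θ.instιβ
      ∀ (K k : ℕ) (X : (domSys (F.P K) M (k + 1)).Dom) (l : Fin (F.P K).d) (t : Site (F.P K) (k + 1)) (cc : θ.ιβ),
        ‖ι K k X (Pi.single l (Pi.single t (θ.bV cc)))‖ ≤ w K k X t)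
    (htail : ∀ (K k : ℕ) (X : (domSys (F.P K) M (k + 1)).Dom) (t : Site (F.P K) (k + 1)),
      let e : Site (F.P K) (k + 1) → TPt 4 (domCount (F.P K) M (k + 1) * M) := fun x i => (ZMod.cast (x i) : ZMod (domCount (F.P K) M (k + 1) * M))
      w K k X t ≤ B₃ * Real.exp (-δ₀ * distCT (domCount (F.P K) M (k + 1)) M (e t) (nearT (M := M) (e t) X)))
    (hκ₅ : delta1 δ₀ κw ((M : ℝ) * 4) ≤ κ₅) (hω : 0 < ℓ.ω) (hθω : ℓ.θ₅ ≤ ℓ.ω ^ 2) (hℓκ : ℓ.κ ≤ delta1 δ₀ κw ((M : ℝ) * 4))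
    (hC₉ : (4 * (2 * C₅ / (1 - ℓ.θ₅) +
        2 * ((16 * E₀ * B₃ ^ 2 / r ^ 2) * Real.exp (delta1 δ₀ κw ((M : ℝ) * 4) * ((M : ℝ) * 4) * 3) * K₀ (4 * 2 ^ 4) (2 * 4) * K₁ 4 (δ₀ / 2))) / θ.γ +
        ((16 * (64 * E₀ / rE ^ 2) * B₃ ^ 2 / r ^ 2) * Real.exp (delta1 δ₀ κw ((M : ℝ) * 4) * ((M : ℝ) * 4) * 3) * K₀ (4 * 2 ^ 4) (2 * 4) *
          K₁ 4 (δ₀ / 2)) * θ.γ / 2) / ℓ.ω ≤ ℓ.C₉) :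
    NE9 ((objectsOfRecord₁₃ F N θ ℓ).EA 0) (Window θ.γ) ℓ.κ ℓ.moduli := by
  have hK : 0 < K₀ 64 8 := K₀_pos 64 8
  have hE₀ : 0 ≤ E₀ := le_trans (by positivity) hrenew
  exact ne9_EA_objectsOfRecord₁₃_of_kernelStepRate_outputCoordHolo' F N θ ℓ hs hγ0 hlim hC₅ h5 m' M hM S emb hloc
    (fun K k X => spaceI (Sg K) (Rz K) M (k + 1) (domSites (F.P K) M (k + 1) X) cs.α₀ cs.α₁) hrE hκ₀ hδ₀ hB₃ hr hE₀ hκw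
    (fun K k i => outputCoordHolo_of_stripSchemas F K (Sg K) (Rz K) (logZ K) (β K) (S K) c hL hLc hN hrE.le hA0 hr₁ hκ hrate hsmall hrenew hγ hκc
      (h226TOnOlder K) (hE K) k i)
    Ec ι Φ U hU hrU hEhol hΦemb hΦsp w hw₀ hw htail hκ₅ hω hθω hℓκ hC₉

open Classical in
/-- ★★★ **THE N22 PIN FACE FROM NODE N18's KERNEL STEP RATE + THE PER-STEP SCHEMAS, NO `hdom`** — `N22At (rateCarriersOfRecord₁₃CoPH 𝔯 F θ hP g₀ os k).u3` for EVERY `k` under K3⁷ v5's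
node-U3 pin at the tuple.  THE N22 ROW SENTENCE in schema currency, repaired: «W1-20's law + N10's older-coupling schema + N09's `EHoloAt` families + N18's kernel step rate + term holomorphy
through the readings + p. 282 tails + (1.21) existence + numerals + letter rows ⇒ v5 §2b `h9` ∕ `N22At` WITH THE RECORD's GEOMETRIC MODULI». [folklore] -/
theorem n22At_rateCarriers_of_kernels_pin_of_kernelStepRate_stripSchemas (𝔯 : RateReading₁₃CoPH N) (θ : Stage13HParams F N) (hP : θ.Provisos₁₃CoPH F N)
    (g₀ : ℕ → ℝ) (os : List (ULoop F)) (ℓ : U3Letters₁₁) (hs : ℓ.Signs) (hγ0 : 0 < θ.γ)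
    (hpin : (𝔯.lit F θ hP g₀ os).u3 = objectsOfRecord₁₃ F N θ.toStage13Params ℓ)
    (hlim : PolLimitsExistOfRecord₁₃ F N θ.toStage13Params) {κ₅ C₅ : ℝ} (hC₅ : 0 ≤ C₅) (h5 : KernelStepRateOfRecord₁₃ F N θ.toStage13Params κ₅ ℓ.θ₅ C₅)
    {𝔸 : Type*} [NormedRing 𝔸] [NormedAlgebra ℂ 𝔸] [CompleteSpace 𝔸] {G : Type*} [GaugeGroup G]
    (m' : ℕ) (M : ℕ) [NeZero M] (hM : M = F.L ^ m')
    (S : (K : ℕ) → ClusterTower (F.P K) 𝔸 M) (emb : ReadingMaps F (MatA N) 𝔸) (hloc : Localizes17OfRecord₁₃ F N θ.toStage13Params S emb)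
    (Sg : (K : ℕ) → Setting 𝔸 G) (Rz : (K : ℕ) → Residual (F.P K) 𝔸) (logZ : (K : ℕ) → ℕ → GaugeField (F.P K) 0 G → ℝ) (β : ℕ → ℕ → ℝ → ℝ)
    (c : B13.Consts) {L : ℕ} [NeZero L] (hL : 8 ≤ c.L) (hLc : c.L = L) {a a₂ a₂' a₅ Aabs : ℝ} (hN : Lemma3Numerics c M ((c.L : ℝ) / 2) a a₂ a₂' a₅ Aabs)
    (cs : SFConsts) (hγ : θ.γ ≤ cs.γ)
    {rE E₀ κ r₁ κw δ₀ B₃ r : ℝ} (hrE : 0 < rE) (hA0 : 0 ≤ c.C3act * c.ε₁) (hr₁ : 0 ≤ r₁) (hκ : κ ≤ r₁)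
    (hrate : r₁ + 2 * (64 * Real.log 162) + 2 ≤ (1 - 8 * c.δ) * ((c.L : ℝ) / 2) * c.κ)
    (hsmall : c.C3act * c.ε₁ * Real.exp (5 * r₁ + 1) * K₀ 64 8 * 9 * 64 ≤ 1)
    (hrenew : Real.exp 1 * 9 * 64 * K₀ 64 8 ^ 2 * (c.C3act * c.ε₁) ≤ E₀) (hκc : κ ≤ cs.κ)
    (hκ₀ : kappa₀ (4 * 2 ^ 4) (2 * 4) ≤ κw / 2) (hκw : κw ≤ κ) (hδ₀ : 0 < δ₀) (hB₃ : 0 ≤ B₃) (hr : 0 < r)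
    (h226TOnOlder : ∀ K : ℕ,
      ∀ (D : Set ℂ), IsOpen D → (∀ t ∈ Ioc (0 : ℝ) θ.γ, closedBall (t : ℂ) rE ⊆ D) →
        ∀ (k : ℕ) (g : ℕ → ℝ), g ∈ Window θ.γ → ∀ (i : ℕ), i < k → ∀ (X : (domSys (F.P K) M (k + 1)).Dom) (φ : CPair (F.P K) 𝔸),
        φ ∈ spaceI (Sg K) (Rz K) M (k + 1) (domSites (F.P K) M (k + 1) X) cs.α₀ cs.α₁ →
        (∀ (j : ℕ), j < k + 1 → ∀ (Y : (domSys (F.P K) M j).Dom) (ψ : CPair (F.P K) 𝔸), ψ ∈ spaceI (Sg K) (Rz K) M j (domSites (F.P K) M j Y) cs.α₀ cs.α₁ →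
          ∃ Ec : ℂ → ℂ, DifferentiableOn ℂ Ec D ∧ (∀ z ∈ D, ‖Ec z‖ ≤ E₀ * Real.exp (-(κ * torusTreeLen Y.1))) ∧
            (∀ t ∈ Ioc (0 : ℝ) θ.γ, Ec t = termC (S K) j Y (Function.update g i t) ψ)) →
        ∃ (Hc : ℂ → TDom 4 (domCount (F.P K) M (k + 1)) → ℂ)
          (Tt : (Z : TDom 4 (domCount (F.P K) M (k + 1))) →
            Finset (TDom 4 (L * domCount (F.P K) M (k + 1))) × Finset (TBond 4 M (L * domCount (F.P K) M (k + 1))) → ℂ → ℂ),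
          (∀ Z : (domSys (F.P K) M (k + 1)).Dom, Z.1 ⊆ X.1 → DifferentiableOn ℂ (fun z => Hc z Z) D) ∧
          (∀ z ∈ D, ∀ Z : TDom 4 (domCount (F.P K) M (k + 1)), Z.1 ⊆ X.1 → ‖Hc z Z‖ ≤ ∑ t ∈ terms L M Z, ‖Tt Z t z‖) ∧
          (∀ z ∈ D, ∀ Z : TDom 4 (domCount (F.P K) M (k + 1)), Z.1 ⊆ X.1 → ∀ t ∈ terms L M Z,
            ‖Tt Z t z‖ ≤ weight L M c Z a t * Real.exp (a₅ * ((Z.1).card : ℝ))) ∧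
          (∀ t ∈ Ioc (0 : ℝ) θ.γ, Hc t = ((S K) k).H (restrictPrefix k (Function.update g i t)) φ))
    (hE : ∀ (K : ℕ), ∀ g ∈ Window θ.γ, ∀ k : ℕ, ∃ H : EHoloAt (sfTowerOfRecord (Sg K) (Rz K) M (S K) ⟨g, β K⟩ (logZ K)) cs k, H.E₀ ≤ E₀ ∧ rE ≤ H.r)
    (Ec : ℕ → ℕ → Type*) [∀ K k, NormedAddCommGroup (Ec K k)] [∀ K k, NormedSpace ℂ (Ec K k)]
    (ι : letI := θ.instVβ₁; letI := θ.instVβ₂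
      (K k : ℕ) → (domSys (F.P K) M (k + 1)).Dom → ((Fin (F.P K).d → Site (F.P K) (k + 1) → θ.Vβ) →L[ℝ] Ec K k))
    (Φ : (K k : ℕ) → (domSys (F.P K) M (k + 1)).Dom → Ec K k → CPair (F.P K) 𝔸)
    (U : (K k : ℕ) → (domSys (F.P K) M (k + 1)).Dom → Set (Ec K k)) (hU : ∀ K k X, IsOpen (U K k X)) (hrU : ∀ K k X, ball (0 : Ec K k) r ⊆ U K k X)
    (hEhol : ∀ g ∈ Window θ.γ, ∀ (K k : ℕ) (X : (domSys (F.P K) M (k + 1)).Dom),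
      DifferentiableOn ℂ (fun z => ((S K) k).E (histPrefix g k) (Φ K k X z) X) (U K k X))
    (hΦemb : letI := θ.instVβ₁; letI := θ.instVβ₂
      ∀ (K k : ℕ) (X : (domSys (F.P K) M (k + 1)).Dom) (B : Fin (F.P K).d → Site (F.P K) (k + 1) → θ.Vβ),
        Φ K k X (ι K k X B) = emb K k (fun l t => NormedSpace.exp (θ.ρ8 (B l t))))
    (hΦsp : ∀ (K k : ℕ) (X : (domSys (F.P K) M (k + 1)).Dom), ∀ z ∈ ball (0 : Ec K k) r,
      Φ K k X z ∈ spaceI (Sg K) (Rz K) M (k + 1) (domSites (F.P K) M (k + 1) X) cs.α₀ cs.α₁)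
    (w : (K k : ℕ) → (domSys (F.P K) M (k + 1)).Dom → Site (F.P K) (k + 1) → ℝ) (hw₀ : ∀ K k X t, 0 ≤ w K k X t)
    (hw : letI := θ.instVβ₁; letI := θ.instVβ₂; letI := θ.instιβ
      ∀ (K k : ℕ) (X : (domSys (F.P K) M (k + 1)).Dom) (l : Fin (F.P K).d) (t : Site (F.P K) (k + 1)) (cc : θ.ιβ),
        ‖ι K k X (Pi.single l (Pi.single t (θ.bV cc)))‖ ≤ w K k X t)
    (htail : ∀ (K k : ℕ) (X : (domSys (F.P K) M (k + 1)).Dom) (t : Site (F.P K) (k + 1)),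
      let e : Site (F.P K) (k + 1) → TPt 4 (domCount (F.P K) M (k + 1) * M) := fun x i => (ZMod.cast (x i) : ZMod (domCount (F.P K) M (k + 1) * M))
      w K k X t ≤ B₃ * Real.exp (-δ₀ * distCT (domCount (F.P K) M (k + 1)) M (e t) (nearT (M := M) (e t) X)))
    (hκ₅ : delta1 δ₀ κw ((M : ℝ) * 4) ≤ κ₅) (hω : 0 < ℓ.ω) (hθω : ℓ.θ₅ ≤ ℓ.ω ^ 2) (hℓκ : ℓ.κ ≤ delta1 δ₀ κw ((M : ℝ) * 4))
    (hC₉ : (4 * (2 * C₅ / (1 - ℓ.θ₅) +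
        2 * ((16 * E₀ * B₃ ^ 2 / r ^ 2) * Real.exp (delta1 δ₀ κw ((M : ℝ) * 4) * ((M : ℝ) * 4) * 3) * K₀ (4 * 2 ^ 4) (2 * 4) * K₁ 4 (δ₀ / 2))) / θ.γ +
        ((16 * (64 * E₀ / rE ^ 2) * B₃ ^ 2 / r ^ 2) * Real.exp (delta1 δ₀ κw ((M : ℝ) * 4) * ((M : ℝ) * 4) * 3) * K₀ (4 * 2 ^ 4) (2 * 4) *
          K₁ 4 (δ₀ / 2)) * θ.γ / 2) / ℓ.ω ≤ ℓ.C₉) (k : ℕ) :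
    N22At (rateCarriersOfRecord₁₃CoPH 𝔯 F θ hP g₀ os k).u3 :=
  n22At_rateCarriers_of_kernels_pin_of_ne9 𝔯 θ hP g₀ os ℓ hs hpin
    (ne9_EA_objectsOfRecord₁₃_of_kernelStepRate_stripSchemas F N θ.toStage13Params ℓ hs hγ0 hlim hC₅ h5 m' M hM S emb hloc Sg Rz logZ β c hL hLc hN cs hγ hrE hA0 hr₁ hκ
      hrate hsmall hrenew hκc hκ₀ hκw hδ₀ hB₃ hr h226TOnOlder hE Ec ι Φ U hU hrU hEhol hΦemb hΦsp w hw₀ hw htail hκ₅ hω hθω hℓκ hC₉) k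

/-! ## §2 The letter rows are jointly satisfiable with `ℓ.Signs` (the junction is NOT degenerate-only — contrast module J37 §2) -/

/-- ★ **NON-VACUITY OF THE LETTER ROWS.**  For every NE5 rate `θ₅ ∈ ]0, 1[`, constants `C₅`, `E₁, C₂ ≥ 0`, window radius `γ > 0` and decay `δ₁ ≥ 0` there IS a letter block `ℓ` with
`ℓ.Signs`, `ℓ.θ₅ = θ₅`, `ℓ.κ = δ₁` and the rows of the kernel-fading road: `0 < ℓ.ω`, `ℓ.θ₅ ≤ ℓ.ω²`, `ℓ.κ ≤ δ₁`, `(4·(2C₅∕(1−θ₅) + 2E₁)∕γ + C₂γ∕2)∕ℓ.ω ≤ ℓ.C₉` — take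
`ω = ρ := (1 + √θ₅)∕2`, `C₉ :=` the left member, `cr := 0`.  So, unlike the uniform-table domination row of p618341 §2 (J37: `B₃ = 0 ∨ E₀ ≤ 0`), the rows of
`ne9_EA_objectsOfRecord₁₃_of_kernelStepRate_stripSchemas` do not force degenerate data. [folklore] -/
theorem exists_letterBlock_rows {θ₅ C₅ E₁ C₂ γ δ₁ : ℝ} (hθ0 : 0 < θ₅) (hθ1 : θ₅ < 1) (hC₅ : 0 ≤ C₅) (hE₁ : 0 ≤ E₁) (hC₂ : 0 ≤ C₂) (hγ : 0 < γ) (hδ₁ : 0 ≤ δ₁) :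
    ∃ ℓ : U3Letters₁₁, ℓ.Signs ∧ ℓ.θ₅ = θ₅ ∧ ℓ.κ = δ₁ ∧ ℓ.C₅ = C₅ ∧ 0 < ℓ.ω ∧ ℓ.θ₅ ≤ ℓ.ω ^ 2 ∧ ℓ.κ ≤ δ₁ ∧
      (4 * (2 * C₅ / (1 - ℓ.θ₅) + 2 * E₁) / γ + C₂ * γ / 2) / ℓ.ω ≤ ℓ.C₉ := by
  set s : ℝ := Real.sqrt θ₅ with hs
  have hs0 : 0 ≤ s := Real.sqrt_nonneg _
  have hs1 : s < 1 := by rw [hs, Real.sqrt_lt' one_pos]; simpa using hθ1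
  have hss : s ^ 2 = θ₅ := by rw [hs, Real.sq_sqrt hθ0.le]
  set ω : ℝ := (1 + s) / 2 with hω
  have hω0 : 0 < ω := by rw [hω]; linarith
  have hω1 : ω < 1 := by rw [hω]; linarith
  have hsω : s ≤ ω := by rw [hω]; linarith
  have hθω : θ₅ ≤ ω ^ 2 := by
    rw [← hss]; exact pow_le_pow_left₀ hs0 hsω 2
  have hθω' : θ₅ ≤ ω := by
    have : ω ^ 2 ≤ ω := by nlinarith
    exact hθω.trans this
  have h1θ : 0 < 1 - θ₅ := by linarith
  set C₉ : ℝ := (4 * (2 * C₅ / (1 - θ₅) + 2 * E₁) / γ + C₂ * γ / 2) / ω with hC₉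
  have hC₉0 : 0 ≤ C₉ := by rw [hC₉]; positivity
  refine ⟨⟨δ₁, θ₅, C₅, C₉, ω, 0, ω⟩, ?_, rfl, rfl, rfl, hω0, hθω, le_rfl, le_rfl⟩
  exact { κ_nonneg := hδ₁, θ₅_pos := hθ0, θ₅_lt_one := hθ1, C₅_nonneg := hC₅, C₉_nonneg := hC₉0, ω_nonneg := hω0.le, ω_lt_one := hω1,
          cr_nonneg := le_rfl, θ₅_le_ρ := hθω', ω_le_ρ := le_rfl, ρ_lt_one := hω1 }

end YMDAG.N22.KernelFading

end
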